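import Mathlib.FieldTheory.IsAlgClosed.Basic
import Literature.AlgebraicGeometry.Motives.Cycles
import Literature.AlgebraicGeometry.Motives.CompleteIntersection
import HarnessLib

/-!
# Chow groups of complete intersections of very small degree (Roitman 1972; Esnault–Levine–Viehweg 1997)

Named fact (D-0014), family `hodge`, layer `Literature/AlgebraicGeometry/Motives`, on the tree's real
carriers `IsSmoothCompleteIntersection` (`Motives/CompleteIntersection`) and `ChowGroup`
(`Motives/Cycles`).

Source READ (the theorem as quoted verbatim in print): Ch. Vial, *Algebraic cycles and fibrations*,
Doc. Math. 18 (2013) 1521–1553 = arXiv:1203.2650, §7.2 (materialised text p. 19): "As explained by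
Esnault–Levine–Viehweg in the introduction of [ELV], it is expected from general conjectures on algebraic
cycles, that if `Y ⊂ Pⁿ_k` is a complete intersection of multidegree `d₁ ≥ … ≥ d_r ≥ 2`, then
`CH_l(Y) = ℚ` for all `l < ⌊(n − Σ_{i ≥ 2} d_i)/d₁⌋` […]. If there is no proof of the above for the
moment, the following theorem however was proved.
**Theorem 7.3** (Esnault–Levine–Viehweg [ELV]). Let `Y ⊂ Pⁿ_k` be a complete intersection of multidegree
`d₁ ≥ … ≥ d_r ≥ 2`.
• If either `d₁ ≥ 3` or `r ≥ l + 1`, assume that `Σ_{i=1}^r C(l + d_i, l + 1) ≤ n`.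
• If `d₁ = … = d_r = 2` and `r ≤ l`, assume that `Σ_{i=1}^r C(l + d_i, l + 1) = r(l + 2) ≤ n − l + r − 1`.
Then `CH_{l'}(Y) = ℚ` for all `0 ≤ l' ≤ l`." Here [ELV] = H. Esnault, M. Levine, E. Viehweg, *Chow
groups of projective varieties of very small degree*, Duke Math. J. 87 (1997) 29–58,
doi:10.1215/s0012-7094-97-08702-0 (zbMATH 0916.14001), and Vial's `CH` has `ℚ`-coefficients
(Notations, p. 3). PRIMARY TEXT READ (reground 2026-08-15, `lit read 10.1215/s0012-7094-97-08702-0`,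
25-page preprint layout): the result is the theorem announced in the Introduction (p. 2: "In this
article, we give the following improved bound (see Theorem 4.5): Suppose `d₁ ≥ … ≥ d_r ≥ 2`, and either
`d₁ ≥ 3` or `r ≥ l + 1`. If `Σ C(l + d_i, l + 1) ≤ n` then `CH_{l'}(X) ⊗ ℚ = ℚ` for `0 ≤ l' ≤ l`") and
proved in §4 as **Theorem 4.6** of that text ("Let `v` be in `V(n; d₁, …, d_r)_k`. Suppose that
`d₁ ≥ 3`, or that `r ≥ l + 1`. If `Σ C(d_i + l, l + 1) ≤ n`, then `X_v` contains a linear space of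
dimension `l`, and `CH_s(X_v)_ℚ = ℚ` for all `s ≤ l`, with generator a linear space of dimension `s`";
`X_v ⊆ ℙⁿ_k` the closed subset defined by `r` forms of degrees `d_i`, `k` algebraically closed
throughout, p. 3); the Introduction's "4.5" and the body's "4.6" are the same statement (Lemma 4.5 of
the body is the numerical lemma). The case `l = 0`
(`Σ d_i ≤ n ⇒ CH₀(Y) ⊗ ℚ = ℚ`) is Roitman's theorem (A. A. Roitman, Mat. Sb. 89 (131) (1972) 569–585),
cf. Hirschowitz–Iyer 2010, §1.3: "The case of `0`-cycles has been handled by Roitman [Ro]".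

## Lean rendering (real definitions of the tree only)

`EsnaultLevineViehweg1997_chowGroup_rank_le_one`: for an algebraically closed field `k` of
characteristic `0` [print: algebraically closed; characteristic `0` only narrows the claim], a smooth
complete intersection `X` of dimension `m` and multidegree `d : Fin c → ℕ` in `P^{m+c}_k` in the sense of
`IsSmoothCompleteIntersection m d X` (smooth projective geometrically irreducible `m`-fold cut out
scheme-theoretically — Jacobian condition — by forms of degrees `d a`; print allows arbitrary, possibly
singular, complete intersections: narrower again), all `d a ≥ 2`, and `l` with (`some d a ≥ 3` or
`l + 1 ≤ c`) and `Σ_a C(l + d a, l + 1) ≤ m + c` (the FIRST bullet only; the all-quadrics bullet is not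
vendored), every `CH_{l'}(X)`, `l' ≤ l`, has `ℚ`-rank `≤ 1`: any two classes of the tree's integral
`ChowGroup X.left l'` are `ℤ`-linearly dependent (`∃ (p, q) ≠ (0, 0), p • x = q • y`). "`CH_{l'}(Y) = ℚ`"
in print is rank EXACTLY one, generated by a linear section; the rendering keeps the half consumers use
as a hypothesis (rank `≤ 1`), so the `Prop` below is implied by the printed theorem.

Instances: `(2,3) ⊂ P⁸`, `l = 0`: `c = 2 ≥ 1`, `2 + 3 = 5 ≤ 8` ✓ — `CH₀ ⊗ ℚ` of every smooth
`(2,3)`-sixfold has rank `≤ 1`; but `l = 1`: `C(3,2) + C(4,2) = 9 > 8` ✗ (that case is Hirschowitz–Iyer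
2010, vendored separately).

grounds `Summit.HodgeConjecture.HodgeConjecture.Theses.SchlafliMinusFive.ChowZeroTrivial23` (item =
fact ∘ (`k = ℂ`, `m = 6`, `d = (2,3)`, `l = 0`) ∘ [route rendering of "smooth (2,3) sixfold" ⇒
`IsSmoothCompleteIntersection 6 ![2, 3] X`, a bridge lemma for the prover]); also the `CH₀` input over
every algebraically closed `L ⊇ ℂ` of `HodgeTheory.Vial2013_hodgeConjectureFor_of_chowGroups_rank_le_one`
for the route target `…SchlafliMinusFive.HodgeAllSmooth23`.

## What is NOT here

* The all-quadrics bullet (`d₁ = … = d_r = 2`, `r ≤ l`), singular complete intersections, positive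
  characteristic, and generation by linear sections (rank exactly one).
* Hirschowitz–Iyer's small-step improvement (file `Motives/HirschowitzIyerQuadricCubic`).
* A proof. The printed proof (ELV §§1–4: Roitman's ruled cycles via Fulton Ch. 6/8 intersection
  products in `ℙⁿ`, `CH_*(ℙⁿ) = ℤ`, the Fano schemes `Gr_k(l; X_v)`, and `A₀(Gr_k(l; X_v))_ℚ = 0` from
  the rational connectedness of Fano varieties, Kollár–Miyaoka–Mori / Campana) is beyond the tree; its
  elementary first steps are PROVED in `Motives/CompleteIntersectionChowGroupsProofs` (Lemma 1.1 and
  Lemma 4.2 a) in coordinates, the Chow-level skeleton of Thm. 4.6) and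
  `Motives/CompleteIntersectionLinesThroughPoints` (Lemma 4.2 a) on the tree's schemes: lines /
  `l`-planes through every closed point).

## References

* [EsnaultLevineViehweg1997] H. Esnault, M. Levine, E. Viehweg, Chow groups of projective varieties of
  very small degree, Duke Math. J. 87 (1997) 29–58, doi:10.1215/s0012-7094-97-08702-0 — Introduction
  p. 2 and Thm. 4.6 (announced as "Theorem 4.5"), first bullet; also quoted in [Vial2013] Thm. 7.3.
* [Vial2013] Ch. Vial, Algebraic cycles and fibrations, Doc. Math. 18 (2013), Thm. 7.3, §7.2.
-/

noncomputable section

open CategoryTheory AlgebraicGeometry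

universe u

namespace Literature.AlgebraicGeometry.Motives

/-- **Esnault–Levine–Viehweg 1997, Thm. 4.6 (= "Theorem 4.5" of the Introduction), first bullet**
(also quoted in Vial 2013, Thm. 7.3; `l = 0` is Roitman 1972): for a smooth complete intersection
`X ⊂ P^{m+c}_k` of dimension `m` and multidegree `d` (`d a ≥ 2`) over an algebraically closed field of
characteristic `0`, if `d a ≥ 3` for some `a` or `l + 1 ≤ c`, and `Σ_a C(l + d a, l + 1) ≤ m + c`, then
for every `l' ≤ l` the group `CH_{l'}(X) ⊗ ℚ` has rank `≤ 1` (print: "`CH_s(X_v)_ℚ = ℚ` for all `s ≤ l`,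
with generator a linear space of dimension `s`", for arbitrary complete intersections `X_v`; rendered
narrower and with the rank-`≤ 1` half of the conclusion — see the module docstring).
[cite: EsnaultLevineViehweg1997, Thm 4.6 (announced as Thm 4.5 in the Introduction), first bullet] [cite: Vial2013, Thm 7.3] -/
def EsnaultLevineViehweg1997_chowGroup_rank_le_one : Prop :=
  ∀ ⦃k : Type u⦄ [Field k] [IsAlgClosed k] [CharZero k] ⦃m c : ℕ⦄ ⦃d : Fin c → ℕ⦄ ⦃X : SchemeOver k⦄,
    IsSmoothCompleteIntersection m d X → (∀ a, 2 ≤ d a) →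
    ∀ ⦃l : ℕ⦄, ((∃ a, 3 ≤ d a) ∨ l + 1 ≤ c) → ∑ a, Nat.choose (l + d a) (l + 1) ≤ m + c →
    ∀ ⦃l' : ℕ⦄, l' ≤ l → ∀ x y : ChowGroup X.left l', ∃ p q : ℤ, (p ≠ 0 ∨ q ≠ 0) ∧ p • x = q • y

/-- **Roitman's range** (`l = 0`): a smooth complete intersection of multidegree `d` (`d a ≥ 2`, `c ≥ 1`
equations) in `P^{m+c}` with `Σ_a d a ≤ m + c` has `CH₀ ⊗ ℚ` of rank `≤ 1` — the `l = 0` case of the fact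
(`C(d, 1) = d`, and `l + 1 = 1 ≤ c`). [cite: Vial2013, Thm 7.3] -/
theorem chowGroup_zero_rank_le_one_of_sum_degree_le (h : EsnaultLevineViehweg1997_chowGroup_rank_le_one.{u})
    {k : Type u} [Field k] [IsAlgClosed k] [CharZero k] {m c : ℕ} {d : Fin c → ℕ} {X : SchemeOver k}
    (hX : IsSmoothCompleteIntersection m d X) (hd : ∀ a, 2 ≤ d a) (hc : 1 ≤ c)
    (hsum : ∑ a, d a ≤ m + c) (x y : ChowGroup X.left 0) :
    ∃ p q : ℤ, (p ≠ 0 ∨ q ≠ 0) ∧ p • x = q • y := by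
  refine h hX hd (l := 0) (Or.inr (by simpa using hc)) ?_ (le_refl 0) x y
  simpa using hsum

/-- The `(2,3)`-sixfold instance used by route `SchlafliMinusFive` (`ChowZeroTrivial23`): every smooth
complete intersection of a quadric and a cubic in `P⁸_k` (`k` algebraically closed of characteristic `0`)
has `CH₀ ⊗ ℚ` of rank `≤ 1` (`2 + 3 = 5 ≤ 8`). [cite: Vial2013, Thm 7.3] -/
theorem chowGroup_zero_rank_le_one_ci23 (h : EsnaultLevineViehweg1997_chowGroup_rank_le_one.{u})
    {k : Type u} [Field k] [IsAlgClosed k] [CharZero k] {X : SchemeOver k}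
    (hX : IsSmoothCompleteIntersection 6 ![2, 3] X) (x y : ChowGroup X.left 0) :
    ∃ p q : ℤ, (p ≠ 0 ∨ q ≠ 0) ∧ p • x = q • y :=
  chowGroup_zero_rank_le_one_of_sum_degree_le h hX (fun a => by fin_cases a <;> simp) (by norm_num)
    (by simp [Fin.sum_univ_two]) x y

end Literature.AlgebraicGeometry.Motives

end
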